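import Literature.NumberTheory.EllipticCurves.Rank1Residual.GVParityIsogenyProofs
import Literature.NumberTheory.EllipticCurves.HeegnerPointsKolyvaginConjugation
import Literature.NumberTheory.EllipticCurves.WeilPairingProofs
import HarnessLib

/-!
# Isogeny invariance of the Greenberg–Vatsal parity type: the sign hypothesis (hc) discharged by the
# Weil pairing

HONEST FRAMING (cell `b2b-bsdres`, home `run/shared/lean/b2b/bsd-rank1-residual/`): the cell deletes
COMBINATION-SHAPED residual classes of the rank-`≤ 1` BSD formula from PUBLISHED theorems only and
types the rest; this is not "finishing BSD". `Proofs`-style file (theorems only), prover x1a gen 2,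
sequel of `GVParityIsogenyProofs.lean`: of the two hypotheses there, (hc) — every complex
conjugation has a non-zero fixed and a non-zero anti-fixed point on `E[p]`, `p` odd — is a THEOREM
of the tree: `RatClosure.exists_eigenvectors` (McCallum 1991 §3 / Gross 1991 Prop. 9.5(1): complex
conjugation has determinant `χ̄_p(c) = -1` on `E[p]` by the Weil pairing,
`WeierstrassCurve.exists_weilPairing_holds`, Silverman *AEC* III.8.1). So the transfer of `GVPar`
along a `ℚ`-isogeny not killing `E[p]` holds given ONLY Serre's ordinary line (hL) at every prime
above `p` for the source curve:

* `exists_fixed_and_antifixed_of_isComplexConjugation` — (hc) for every elliptic `W/ℚ`, `p` odd.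
* `gvPar_of_isogeny_of_ordinaryLine`, `gvPar_iff_of_isogeny_of_ordinaryLine` — the transfer and
  the iff with (hc) discharged; the remaining hypothesis (hL) is Serre 1972 §1.11 Prop. 11 + Cor.
  at a good ordinary odd `p` (the tree's `exists_line_geomTorsion_of_not_dvd_frobeniusTraceAt` in
  `absInertia` form; the `𝔓.inertia` form is left to a sequel).

## References
* W. G. McCallum, in *L-functions and Arithmetic* (LMS LNS 153, 1991), §3. [McCallumLMS1991]
* R. Greenberg, V. Vatsal, Invent. Math. 142 (2000), Thm. (1.3). [GreenbergVatsal2000]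
* J.-P. Serre, Invent. Math. 15 (1972), §1.11. [SerreInventiones1972]
* J. H. Silverman, *AEC*, III.8.1. [SilvermanAEC2009]
-/

set_option autoImplicit false

noncomputable section

open scoped Classical

open WeierstrassCurve Literature.NumberTheory.EllipticCurves Literature.NumberTheory.GaloisRepresentations
  Field IsDedekindDomain NumberField

namespace Literature.NumberTheory.EllipticCurves.Rank1Residual

variable {W W' : WeierstrassCurve ℚ} [W.IsElliptic] [W'.IsElliptic] {p : ℕ} [Fact p.Prime]

variable (W) in
/-- **(hc) holds**: for `p` odd and `W/ℚ` elliptic, every complex conjugation of `Γ_ℚ` has a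
non-zero fixed and a non-zero anti-fixed point on `E[p]` (Weil pairing: `det ρ̄_{E,p}(c) =
χ̄_p(c) = -1`; tree `RatClosure.exists_eigenvectors` + `WeierstrassCurve.exists_weilPairing_holds`).
[cite: McCallumLMS1991, §3 (before Prop. 3.1)] -/
theorem exists_fixed_and_antifixed_of_isComplexConjugation (hp2 : p ≠ 2)
    (c : absoluteGaloisGroup ℚ) (hc : IsComplexConjugation (Rat.castHom ℝ) c) :
    (∃ P : geomTorsion W (p : ℤ), P ≠ 0 ∧ c • P = P) ∧
      (∃ Q : geomTorsion W (p : ℤ), Q ≠ 0 ∧ c • Q = -Q) :=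
  RatClosure.exists_eigenvectors W hc (WeierstrassCurve.exists_weilPairing_holds W p) hp2

omit [W'.IsElliptic] in
/-- **Transfer of `GVPar` along an isogeny, given Serre's ordinary line only.** For a `ℚ`-isogeny
`f : E → E'` with `E[p] ⊄ ker f`, `p` odd, and (hL) for `E` (at every prime `𝔓` above `p` a
subgroup `L ≤ E[p]` of order `p` containing all `σ • P - P`, `σ ∈ I_𝔓`, and moved by some
`σ ∈ I_𝔓`): `GVPar W p → GVPar W' p`. (`gvPar_of_isogeny` with (hc) discharged.) [folklore] -/
theorem gvPar_of_isogeny_of_ordinaryLine (hp2 : p ≠ 2)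
    (hL : ∀ (v : HeightOneSpectrum (𝓞 ℚ)), (p : 𝓞 ℚ) ∈ v.asIdeal → ∀ 𝔓 ∈ v.primesAbove,
      ∃ L : AddSubgroup (geomTorsion W (p : ℤ)), Nat.card L = p ∧
        (∀ σ ∈ 𝔓.inertia (absoluteGaloisGroup ℚ), ∀ P : geomTorsion W (p : ℤ), σ • P - P ∈ L) ∧
        (∃ σ ∈ 𝔓.inertia (absoluteGaloisGroup ℚ), ∃ P ∈ L, σ • P ≠ P))
    (f : Isogeny W W') (hf : ∃ P : geomPoints W, P ∈ geomTorsion W (p : ℤ) ∧ f P ≠ 0)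
    (h : GVPar W p) : GVPar W' p :=
  gvPar_of_isogeny hp2 hL (exists_fixed_and_antifixed_of_isComplexConjugation W hp2) f hf h

/-- **Isogeny invariance of the Greenberg–Vatsal parity type, given Serre's ordinary lines.** For
`ℚ`-isogenies `f : E → E'`, `f' : E' → E` not killing the `p`-torsion, `p` odd, and (hL) for both
curves: `GVPar W p ↔ GVPar W' p`. [folklore] -/
theorem gvPar_iff_of_isogeny_of_ordinaryLine (hp2 : p ≠ 2)
    (hL : ∀ (v : HeightOneSpectrum (𝓞 ℚ)), (p : 𝓞 ℚ) ∈ v.asIdeal → ∀ 𝔓 ∈ v.primesAbove,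
      ∃ L : AddSubgroup (geomTorsion W (p : ℤ)), Nat.card L = p ∧
        (∀ σ ∈ 𝔓.inertia (absoluteGaloisGroup ℚ), ∀ P : geomTorsion W (p : ℤ), σ • P - P ∈ L) ∧
        (∃ σ ∈ 𝔓.inertia (absoluteGaloisGroup ℚ), ∃ P ∈ L, σ • P ≠ P))
    (hL' : ∀ (v : HeightOneSpectrum (𝓞 ℚ)), (p : 𝓞 ℚ) ∈ v.asIdeal → ∀ 𝔓 ∈ v.primesAbove,
      ∃ L : AddSubgroup (geomTorsion W' (p : ℤ)), Nat.card L = p ∧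
        (∀ σ ∈ 𝔓.inertia (absoluteGaloisGroup ℚ), ∀ P : geomTorsion W' (p : ℤ), σ • P - P ∈ L) ∧
        (∃ σ ∈ 𝔓.inertia (absoluteGaloisGroup ℚ), ∃ P ∈ L, σ • P ≠ P))
    (f : Isogeny W W') (hf : ∃ P : geomPoints W, P ∈ geomTorsion W (p : ℤ) ∧ f P ≠ 0)
    (f' : Isogeny W' W) (hf' : ∃ P : geomPoints W', P ∈ geomTorsion W' (p : ℤ) ∧ f' P ≠ 0) :
    GVPar W p ↔ GVPar W' p :=
  ⟨gvPar_of_isogeny_of_ordinaryLine hp2 hL f hf, gvPar_of_isogeny_of_ordinaryLine hp2 hL' f' hf'⟩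

end Literature.NumberTheory.EllipticCurves.Rank1Residual

end
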